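import Summits.QuantumFields.Balaban3D.Proofs.Bound55AC
import HarnessLib

/-!
# Ideator 2 (seat `ym-cruxidea-19201-2`, gen 6, NEGATION lens) — FINDING N7 «the trivial-history mass IS the Jacobian; print never forms it»
# crux `FluctuationComparisonRegPr` (stmt-QuantumFields-19201, aside) / live twin `FluctuationComparisonRegPrL` (stmt-QuantumFields-19935),
# skeleton v5h STUB 3′ `stub_alphaTwoRunOfLane`, conjunct (A) `RepAtHeights`; the seam typed by ★ym-ust-19201-p2 g3 as
# `T3AlphaInputsACTrivEnvelope.OneStepUpperTrivAt ⇐ Fibre49AC(triv) ∧ HaarCompatT3` (finding F-g3-1) and by the OWNER (g17 04:57Z (c), «upper-mod-mass»,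
# KEY RISK «(1/N³)|log m_{K−n}(triv,V)| → 0»).

WHAT THIS FILE PROVES (sorry-free; [folklore] order theory / measure theory; nothing of [Balaban1985UV3] is asserted):

§1 FLOORS ONLY ADD — in EVERY transport typing the trivial mass is governed by the Jacobian chain `J^{(k)} := T_{k−1} ⋯ T_0 1`
   (`T_k 1 = d(Ū_k)_*(dU)/dV`, `= 1` a.e. iff exact Haar compatibility E6′): for monotone `T_k`,
   * `jac_le_massFloor`   — the lane's floored mass `m_{k+1} = max 1 (T_k m_k)` (`MassesAC.massRecAC` at triv) satisfies `J^{(k)} ≤ m_k` and `1 ≤ m_k`,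
     so its excess over print's mass `1` is `≥ (log J^{(k)})₊`;
   * `jac_le_massWin`     — a WINDOWED floor `max χ_{k+1} (T_k m_k)` (the «windowed floor» of the owner's (c) / ★18916-p1 F-g3-3 (B)) still has `J^{(k)} ≤ m_k`;
   * `massChain_le_jac`   — the UNFLOORED windowed chain `χ_{k+1}·T_k m′_k` (★alpha-1 F-α1-11's direction for 19936) has `m′_k ≤ J^{(k)}` — its
     upper-envelope excess is `≤ (log J^{(k)})₊`, i.e. it needs a POINTWISE law `J^{(k)} ≤ 1 + o(1)` on the window, uniformly in the cut-off;
   * `massFloor_eq_one_of_T_one` — under E6′ (`T_k 1 = 1`) the floored mass is identically `1` (F-g3-1's «⟸»).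
   Reading (memo FINDING-N7 §2): `log J^{(k)}` is an EXTENSIVE functional of the finest field (sum of local defects over `≍ L^{3(K+m−1)}` finest blocks)
   whose local constant is NON-ZERO in structure for non-abelian `G` (cell ym-nodeO-ideate P2 R-50.6/R-52.1; ym-instrument Q-C3 `D(w²) = +2.714(15)·10⁻⁴`,
   18.6σ) though astronomically small under `dU` (`≈ 10⁻²⁰⁹` per 2-cycle, P2 52-b (iii)) — so NO cut-off-uniform pointwise law exists short of E6′ itself,
   which is false in structure: every transport typing of the trivial mass is dead for the POINTWISE consumer 19935 (the integral consumer 19936 is fine: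
   `∫ T f dV = ∫ f dU`).
§2 THE CONSUMER'S TOLERANCE IS ABSOLUTE AND SUMMABLE, so a bounded slack does not «settle» it: `abs_sub_half_le` (a one-sided slack `b ≥ 0` can be
   re-centred into the constant `κ` only if it is `V`-independent; a `V`-dependent slack of sup `b_K` costs `b_K/2` in `r_K`) and `not_summable_log_two`
   (the owner's «windowed floor ≤ 2 ⇒ log 2/N³ → 0» is the wrong normalisation for `T3RegularMinimiser.BgFluctuationAt`: `Σ r_K < ∞`, no `1/N³`).
§3 THE PRINT-FAITHFUL EXIT, TYPED: `Fibre55TrivAC` — [Balaban1985UV3] (49) ≤ (55)·(58) p.269–270 AT THE TRIVIAL HISTORY, UNFACTORED («(The integral (49))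
   ≤ χ_{k+1} exp[−(1/g_k²)A^η(U_{k+1}) − E_k + log σ₀|B(Λ_{k+1})*| + … + (the constants in (41))]»: print bounds the WHOLE constrained integral, Jacobian
   inside, by the next envelope; it never forms `T_k 1`).  It is the `≤ᵐ`-twin of the lane's EXISTING unfactored LOWER residual `Bound55AC.Fibre57LowAC`
   and differs from `Bound55AC.Fibre49AC … (Hist.triv …)` exactly by the two mass factors `m_k(triv)` (left) and `T_k[w·m_k(triv)]` (right).
§4 THE LEAF NEEDS NO `hm₁` AT THE TRIVIAL HISTORY: `transport41_le_sum_ae_direct` — ★alpha-1's `TransportAC.transport41_le_sum_ae_of_ac` re-run with the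
   pair (`hm₁`, `hfibre`) replaced by ONE direct fibre hypothesis `T_k[w·χB·m₀·e^{F₀}] ≤ᵐ m₁(h′)·B(h′)` (the only form the proof consumes);
   `direct_of_factored` recovers alpha-1's hypotheses as a special case, and `direct_triv_of_unfactored` shows that with the trivial mass PINNED
   `m₁(triv) := 1` (seat p1's original design) the direct hypothesis at `h′ = triv` IS the unfactored row (§3) — no transport of a constant, no `T_k 1`,
   no E6′.  So: `OneStepUpperTrivAt ⇐ Fibre55TrivAC` BY READING (the twin of ★ym-ust-19201-p2's `…RepAtHeightsLowerRow`), and conjunct (A) of STUB 3′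
   closes from a v3 package `= v2 + Fibre55TrivAC` with `HaarCompatT3` DELETED.

References: T. Bałaban, Commun. Math. Phys. 102 (1985) 255–275 [Balaban1985UV3] ((41) p.266, (47)–(49) pp.267–268, (55)·(58) pp.269–270, p.272 L32–33);
Commun. Math. Phys. 98 (1985) 17–51 [Balaban1985Averaging] ((10) p.19: the INTEGRATED identity only).
-/

noncomputable section

namespace Summit.QuantumFields.YangMills.Cruxes.FluctuationComparisonRegPr.Ideate2Gen6

/-! ## §1 Floors only add: every transport typing of the trivial mass is governed by the Jacobian chain — PROVED -/

section Floors

variable {α : Type*} (T : ℕ → (α → ℝ) → (α → ℝ))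

/-- The Jacobian chain `J^{(0)} = 1`, `J^{(k+1)} = T_k J^{(k)}` (for `T_k = rnTransport Ū_k`: the density of the `k+1`-fold push-forward of product
Haar w.r.t. product Haar; `≡ 1` iff exact Haar compatibility at every step). [folklore] -/
def jac : ℕ → α → ℝ
  | 0 => fun _ => 1
  | k + 1 => T k (jac k)

/-- The lane's FLOORED trivial mass (`MassesAC.massRecAC` at `Hist.triv`, `w_k(triv) ≡ 1`): `m_0 = 1`, `m_{k+1} = max 1 (T_k m_k)`. [folklore] -/
def massFloor : ℕ → α → ℝ
  | 0 => fun _ => 1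
  | k + 1 => fun x => max 1 (T k (massFloor k) x)

/-- A WINDOWED floor: `m_{k+1} = max χ_{k+1} (T_k m_k)` (`χ` a window indicator, or any function). [folklore] -/
def massWin (χ : ℕ → α → ℝ) : ℕ → α → ℝ
  | 0 => fun _ => 1
  | k + 1 => fun x => max (χ (k + 1) x) (T k (massWin χ k) x)

/-- The UNFLOORED windowed chain `m′_0 = 1`, `m′_{k+1} = χ_{k+1} · T_k m′_k` (`∫ m′ ≤ 1`; F-α1-11's «unfloored chain χ·T_k[χ·T_{k−1}[⋯]]»). [folklore] -/
def massChain (χ : ℕ → α → ℝ) : ℕ → α → ℝ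
  | 0 => fun _ => 1
  | k + 1 => fun x => χ (k + 1) x * T k (massChain χ k) x

variable {T}

/-- `1 ≤ m_k` for the floored mass (the lane's `MassesAC.one_le_massRecAC_triv`). [folklore] -/
theorem one_le_massFloor : ∀ (k : ℕ) (x : α), 1 ≤ massFloor T k x
  | 0, _ => le_rfl
  | _ + 1, _ => le_max_left _ _

/-- **FLOORS ONLY ADD**: for monotone `T_k`, the floored trivial mass dominates the Jacobian chain, `J^{(k)} ≤ m_k` — so `log m_k ≥ (log J^{(k)})₊`:
the upper-envelope excess of the AC tower at the trivial history is AT LEAST the positive part of the iterated Jacobian. [folklore] -/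
theorem jac_le_massFloor (hT : ∀ k (f g : α → ℝ), f ≤ g → T k f ≤ T k g) : ∀ k : ℕ, jac T k ≤ massFloor T k
  | 0 => le_rfl
  | k + 1 => fun x => (hT k _ _ (jac_le_massFloor hT k) x).trans (le_max_right _ _)

/-- **A WINDOWED FLOOR STILL CARRIES THE JACOBIAN**: `J^{(k)} ≤ max χ (T m)`-masses, whatever `χ` is. [folklore] -/
theorem jac_le_massWin (hT : ∀ k (f g : α → ℝ), f ≤ g → T k f ≤ T k g) (χ : ℕ → α → ℝ) : ∀ k : ℕ, jac T k ≤ massWin T χ k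
  | 0 => le_rfl
  | k + 1 => fun x => (hT k _ _ (jac_le_massWin hT χ k) x).trans (le_max_right _ _)

/-- The unfloored windowed chain is non-negative (`χ ≥ 0`, `T_k` positivity-preserving). [folklore] -/
theorem massChain_nonneg (hT0 : ∀ k (f : α → ℝ), 0 ≤ f → 0 ≤ T k f) {χ : ℕ → α → ℝ} (hχ0 : ∀ k x, 0 ≤ χ k x) :
    ∀ k : ℕ, 0 ≤ massChain T χ k
  | 0 => fun _ => zero_le_one
  | k + 1 => fun x => mul_nonneg (hχ0 _ x) (hT0 k _ (massChain_nonneg hT0 hχ0 k) x)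

/-- **THE UNFLOORED WINDOWED CHAIN IS DOMINATED BY THE JACOBIAN**: `m′_k ≤ J^{(k)}` (`0 ≤ χ ≤ 1`, `T_k` monotone and positivity-preserving) — so
its pointwise upper-envelope excess is `≤ (log J^{(k)})₊`: small iff a POINTWISE law `J^{(k)} ≤ 1 + o(1)` holds on the window. [folklore] -/
theorem massChain_le_jac (hT : ∀ k (f g : α → ℝ), f ≤ g → T k f ≤ T k g) (hT0 : ∀ k (f : α → ℝ), 0 ≤ f → 0 ≤ T k f)
    {χ : ℕ → α → ℝ} (hχ0 : ∀ k x, 0 ≤ χ k x) (hχ1 : ∀ k x, χ k x ≤ 1) : ∀ k : ℕ, massChain T χ k ≤ jac T k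
  | 0 => le_rfl
  | k + 1 => fun x => by
    show χ (k + 1) x * T k (massChain T χ k) x ≤ T k (jac T k) x
    have h0 : 0 ≤ T k (massChain T χ k) x := hT0 k _ (massChain_nonneg hT0 hχ0 k) x
    calc χ (k + 1) x * T k (massChain T χ k) x ≤ 1 * T k (massChain T χ k) x := mul_le_mul_of_nonneg_right (hχ1 _ x) h0
      _ = T k (massChain T χ k) x := one_mul _
      _ ≤ T k (jac T k) x := hT k _ _ (massChain_le_jac hT hT0 hχ0 hχ1 k) x

/-- **UNDER E6′ THE FLOOR IS IDLE**: if every `T_k` fixes the constant `1`, the floored mass is identically `1` (F-g3-1 «⟸»; with §1's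
`jac_le_massFloor` the floored excess vanishes iff `(J^{(k)} − 1)₊ = 0` at every level). [folklore] -/
theorem massFloor_eq_one_of_T_one (h1 : ∀ k, T k (fun _ => (1 : ℝ)) = fun _ => 1) : ∀ k : ℕ, massFloor T k = fun _ => 1
  | 0 => rfl
  | k + 1 => by
    funext x
    show max 1 (T k (massFloor T k) x) = 1
    rw [massFloor_eq_one_of_T_one h1 k, h1 k, max_self]

/-- The Jacobian chain of constant-fixing operators is `1` (E6′ at every step ⇒ `J^{(k)} ≡ 1`). [folklore] -/
theorem jac_eq_one_of_T_one (h1 : ∀ k, T k (fun _ => (1 : ℝ)) = fun _ => 1) : ∀ k : ℕ, jac T k = fun _ => 1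
  | 0 => rfl
  | k + 1 => by show T k (jac T k) = _; rw [jac_eq_one_of_T_one h1 k, h1 k]

end Floors

/-! ## §2 The consumer's tolerance is absolute and summable — PROVED -/

section Tolerance

/-- **RE-CENTRING A ONE-SIDED SLACK**: from the two-sided representation with an extra non-negative slack `b` on the upper side only
(`−R ≤ X ≤ R + b`, the shape «upper-mod-mass» gives with `b = log m(triv) ≥ 0`; no sign needed), the symmetric form is `|X − b/2| ≤ R + b/2` — the half-slack
joins the constant `κ_K` only if `b` is `V`-independent; a `V`-dependent slack enters `r_K` with its window-sup. [folklore] -/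
theorem abs_sub_half_le {X R b : ℝ} (hl : -R ≤ X) (hu : X ≤ R + b) : |X - b / 2| ≤ R + b / 2 := by
  rw [abs_le]; constructor <;> linarith

/-- A constant positive sequence is not summable. [folklore] -/
theorem not_summable_const_of_pos {c : ℝ} (hc : 0 < c) : ¬ Summable (fun _ : ℕ => c) := fun h =>
  hc.ne' (tendsto_nhds_unique tendsto_const_nhds h.tendsto_cofinite_zero)

/-- **A BOUNDED SLACK DOES NOT SETTLE A SUMMABLE TOLERANCE**: the slack `log 2` of a «windowed floor ≤ 2» at every cut-off is not summable —
`T3RegularMinimiser.BgFluctuationAt` asks `Σ_K r_K < ∞` with NO volume normalisation, so «log 2/N³ → 0» is not its criterion. [folklore] -/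
theorem not_summable_log_two : ¬ Summable (fun _ : ℕ => Real.log 2) :=
  not_summable_const_of_pos (Real.log_pos one_lt_two)

/-- … whereas the representation slack the socket tolerates is summable by hypothesis: if the mass slack `b_K` IS summable (e.g. `b ≡ 0`,
print's mass `1`), the re-centred radius `R_K + b_K/2` is summable. [folklore] -/
theorem summable_radius_of_summable_slack {R b : ℕ → ℝ} (hR : Summable R) (hb : Summable b) :
    Summable (fun K => R K + b K / 2) :=
  hR.add (hb.div_const 2)

end Tolerance

/-! ## §3 The print-faithful exit, typed over the lane: the UNFACTORED upper residual at the trivial history -/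

section Row

open _root_.MeasureTheory
open Literature.MathematicalPhysics.QuantumFieldTheory.Balaban1983to89
open Literature.MathematicalPhysics.QuantumFieldTheory.Balaban1983to89.AveragingRT (rnTransport)
open Literature.MathematicalPhysics.QuantumFieldTheory.Balaban1983to89.B10SectAGathering (StepPieces)
open Literature.MathematicalPhysics.QuantumFieldTheory.Balaban1985CMP102
open Literature.MathematicalPhysics.QuantumFieldTheory.Balaban1985CMP102.Setting
open Summit.QuantumFields.Balaban3D.Carriers
open Summit.QuantumFields.Balaban3D.Proofs.Bound55Masses (chiB)
open Summit.QuantumFields.Balaban3D.Proofs.MassesAC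
open Summit.QuantumFields.Balaban3D.Proofs.TowerAC
open Summit.QuantumFields.Balaban3D.Proofs.SeriesAC
open Summit.QuantumFields.Balaban3D.Proofs.StandardAC
open Summit.QuantumFields.Balaban3D.Proofs.Bound55AC (Fibre49AC Fibre57LowAC)

variable {L : ℕ} {S : Scales L} {G : Type} [GaugeGroup G] [MeasurableSpace G] [HaarData G] [RegularGaugeGroup G]
variable {V : Type} [NormedAddCommGroup V] [NormedSpace ℂ V]
  (X : ExternalInputsAC S G) (K : CarrierConsts) (𝔖 : ∀ k, StepSeries S G V (nblkOf S K k) k) (slot : ℕ → Prop) (k : ℕ)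

/-- **RESIDUAL R3D-03 `Fibre55Triv` ON THE AC TOWER (proposed)** — [Balaban1985UV3] (49) ≤ (51) ≤ (55)·(58) pp.268–270 AT THE TRIVIAL NEW HISTORY
(`Ω_{k+1} = T_η`, no large-field region, so no (48)-term), UNFACTORED, exactly as printed: «(The integral (49)) ≤ χ_{k+1} exp[−(1/g_k²)A^η(U_{k+1}) − E_k
+ log σ₀|B(Λ_{k+1})*| + … + (the constants in (41))]» (p.269; the Gaussian `δ(QA)`-integral and its determinants — the Jacobian of `Ū` on the small-field
fibre — are INSIDE print's bound and land in `E_{k+1}`, `log Z`, `𝒫_{k+1}`).  Letters: the lane's `Bound55AC.Fibre49AC X K 𝔖 slot k P (Hist.triv …)` with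
its two mass factors — `m_k(triv)` inside the transport on the left, `T_k[w_k(triv)·m_k(triv)]` on the right — REPLACED BY `1` (print's trivial-history
mass), and print's `χ_{k+1}` restored on the right; it is the `≤ᵐ`-twin (sides and direction swapped, `−Rm ↦ +Rm`) of the lane's EXISTING unfactored lower
residual `Bound55AC.Fibre57LowAC`.  A (β) ρ-display ASSUMED, not proved (status RESIDUAL, same standing as R3D-01/02); under `AvgAC` alone it is
INCOMPARABLE with `Fibre49AC … (Hist.triv …)` (they coincide iff `T_k 1 = 1` a.e.). [cite: Balaban1985UV3, (49)–(55) pp.268–269 + (58) p.270] -/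
def Fibre55TrivAC (P : StepPieces ((stdTowerInputAC X K 𝔖).towerWith slot).toTowerRun k) : Prop :=
  (rnTransport (X.av k).avg (fun U =>
    stepWeight K.M₁ (rcolOf S K) (eps1Of S K) (epsSOf S K) k (Hist.triv S.P (k + 1)) U *
      chiB K.M₁ (rcolOf S K) (eps1Of S K) k (Hist.triv S.P (k + 1)) U *
      Real.exp (-(((stdTowerInputAC X K 𝔖).towerWith slot).mainT k (Hist.triv S.P k) U) + (stdTowerInputAC X K 𝔖).Pint k (Hist.triv S.P k) U
        - ((stdTowerInputAC X K 𝔖).towerWith slot).Ecst k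
        + ((stdTowerInputAC X K 𝔖).towerWith slot).Zterm k (Hist.triv S.P k) + ((stdTowerInputAC X K 𝔖).towerWith slot).Rm k)))
  ≤ᵐ[fieldMeasure S.P (k + 1) G] fun W =>
    ((stdTowerInputAC X K 𝔖).towerWith slot).chi (k + 1) W *
    Real.exp (-(((stdTowerInputAC X K 𝔖).towerWith slot).mainT (k + 1) (Hist.triv S.P (k + 1)) W) - ((stdTowerInputAC X K 𝔖).towerWith slot).Ecst k
      + (P.logσ₀ + P.dg * Real.log (S.gk k)) * P.starB (Hist.triv S.P (k + 1)) + P.logZU (Hist.triv S.P (k + 1)) W + P.Pold (Hist.triv S.P (k + 1)) W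
      + ((stdTowerInputAC X K 𝔖).towerWith slot).Zterm k (P.proj (Hist.triv S.P (k + 1))) + ((stdTowerInputAC X K 𝔖).towerWith slot).Rm k
      + P.logFl (Hist.triv S.P (k + 1)) W)

/-- **THE TWO-SIDED TRIVIAL-HISTORY STEP, MASS-FREE** (proposed bundle for a v3 package): lower = the lane's `Fibre57LowAC`, upper = `Fibre55TrivAC`;
both unfactored, both printed ((57)/(47) p.267 + p.272 L32–33 resp. (55) p.269), neither mentions a mass or `T_k 1`. [cite: Balaban1985UV3, (55) p.269 + p.272 L32–33] -/
def TrivStepRowsAC (P : StepPieces ((stdTowerInputAC X K 𝔖).towerWith slot).toTowerRun k) : Prop :=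
  Fibre57LowAC X K 𝔖 slot k P ∧ Fibre55TrivAC X K 𝔖 slot k P

end Row

/-! ## §4 The (48)–(49) leaf needs no `hm₁` at the trivial history — PROVED -/

section Leaf

open _root_.MeasureTheory
open Literature.MathematicalPhysics.QuantumFieldTheory.Balaban1983to89
open Literature.MathematicalPhysics.QuantumFieldTheory.Balaban1983to89.AveragingRT (rnTransport rnTransport_nonneg)
open Summit.QuantumFields.Balaban3D.Carriers (AvgAC)
open Summit.QuantumFields.Balaban3D.Proofs.RTAlgebra
open Summit.QuantumFields.Balaban3D.Proofs.Transport48 (rnTransport_mono_ae rnTransport_sum_ae integrable_weight_mul)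

variable {P : Params} {j : ℕ} {G : Type*} [GaugeGroup G] [MeasurableSpace G] [HaarData G]
  {avg : GaugeField P j G → GaugeField P (j + 1) G}
variable {H₀ H₁ : Type*} [Fintype H₀] [Fintype H₁]

/-- **(48)–(49) dV-a.e. UNDER `AvgAC`, DIRECT FIBRE FORM**: ★alpha-1's `TransportAC.transport41_le_sum_ae_of_ac` with the pair (`hm₁` : transported
weighted old masses below the new masses; `hfibre` : fibre inequality in FACTORED form `T[g h′] ≤ T[w·m₀]·B`) replaced by the ONE hypothesis the proof
actually consumes, `hdirect : T[g h′] ≤ᵐ m₁(h′)·B(h′)`.  Same proof, steps A–D verbatim; step E reads `hdirect`.  With `m₁(triv) := 1` PINNED the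
trivial-history instance of `hdirect` is print's UNFACTORED (55) (§3 `Fibre55TrivAC`, `direct_triv_of_unfactored`); for `h′ ≠ triv` it is the lane's
`Fibre49AC` + `MassesAC.massRecAC_succ` (`direct_of_factored`). [cite: Balaban1985UV3, (48)–(49) pp.267–268] -/
theorem transport41_le_sum_ae_direct (hac : AvgAC avg)
    (proj : H₁ → H₀) (ρ : Density P j G) (hρ : Integrable ρ (fieldMeasure P j G))
    (m₀ : H₀ → Density P j G) (F₀ : H₀ → GaugeField P j G → ℝ)
    (w χB : H₁ → Density P j G) (m₁ B : H₁ → Density P (j + 1) G)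
    (h41 : ∀ U, ρ U ≤ ∑ h, m₀ h U * Real.exp (F₀ h U))
    (hint : ∀ h, Integrable (fun U => m₀ h U * Real.exp (F₀ h U)) (fieldMeasure P j G))
    (hm₀0 : ∀ h U, 0 ≤ m₀ h U)
    (hw : ∀ h', Measurable (w h')) (hw0 : ∀ h' U, 0 ≤ w h' U) (hw1 : ∀ h' U, w h' U ≤ 1)
    (hχ : ∀ h', Measurable (χB h')) (hχ0 : ∀ h' U, 0 ≤ χB h' U) (hχ1 : ∀ h' U, χB h' U ≤ 1)
    (hcover : ∀ h U, m₀ h U ≠ 0 → ∃ h', proj h' = h ∧ (1 : ℝ) ≤ w h' U * χB h' U)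
    (hdirect : ∀ h', (rnTransport avg (fun U => w h' U * χB h' U * (m₀ (proj h') U * Real.exp (F₀ (proj h') U))))
      ≤ᵐ[fieldMeasure P (j + 1) G] fun V => m₁ h' V * B h' V) :
    rnTransport avg ρ ≤ᵐ[fieldMeasure P (j + 1) G] fun V => ∑ h', m₁ h' V * B h' V := by
  classical
  set R : Density P j G := fun U => ∑ h, m₀ h U * Real.exp (F₀ h U) with hR
  set g : H₁ → Density P j G := fun h' U => w h' U * χB h' U * (m₀ (proj h') U * Real.exp (F₀ (proj h') U)) with hg
  have hRi : Integrable R (fieldMeasure P j G) := integrable_finsetSum _ fun h _ => hint h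
  have hgi : ∀ h', Integrable (g h') (fieldMeasure P j G) := fun h' =>
    integrable_weight_mul (hw h') (hχ h') (hw0 h') (hw1 h') (hχ0 h') (hχ1 h') (hint (proj h'))
  have hg0 : ∀ h' U, 0 ≤ g h' U := fun h' U =>
    mul_nonneg (mul_nonneg (hw0 h' U) (hχ0 h' U)) (mul_nonneg (hm₀0 _ U) (Real.exp_pos _).le)
  -- Step A: `Tρ ≤ T R` a.e.
  have hA : rnTransport avg ρ ≤ᵐ[fieldMeasure P (j + 1) G] rnTransport avg R := rnTransport_mono_ae hac h41 hρ hRi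
  -- Step B: `T R = Σ_h T(m₀ h e^{F₀ h})` a.e.
  have hBsum : rnTransport avg R =ᵐ[fieldMeasure P (j + 1) G]
      fun V => ∑ h, rnTransport avg (fun U => m₀ h U * Real.exp (F₀ h U)) V :=
    rnTransport_sum_ae hac Finset.univ (fun h U => m₀ h U * Real.exp (F₀ h U)) fun h _ => hint h
  -- Step C: for each old history, insert the decomposition of unity and transport
  have hC : ∀ h, rnTransport avg (fun U => m₀ h U * Real.exp (F₀ h U)) ≤ᵐ[fieldMeasure P (j + 1) G]
      rnTransport avg (fun U => ∑ h' ∈ Finset.univ.filter (fun h' => proj h' = h), g h' U) := fun h => by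
    refine rnTransport_mono_ae hac (fun U => ?_) (hint h) (integrable_finsetSum _ fun h' _ => hgi h')
    by_cases hm : m₀ h U = 0
    · rw [hm, zero_mul]; exact Finset.sum_nonneg fun h' _ => hg0 h' U
    · have hpos : 0 ≤ m₀ h U * Real.exp (F₀ h U) := mul_nonneg (hm₀0 h U) (Real.exp_pos _).le
      have hsum : ∑ h' ∈ Finset.univ.filter (fun h' => proj h' = h), g h' U
          = (∑ h' ∈ Finset.univ.filter (fun h' => proj h' = h), w h' U * χB h' U) * (m₀ h U * Real.exp (F₀ h U)) := by
        rw [Finset.sum_mul]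
        refine Finset.sum_congr rfl fun h' hh' => ?_
        rw [Finset.mem_filter] at hh'
        rw [hg]; simp only [hh'.2]
      rw [hsum]
      obtain ⟨h₁, hh₁, hone⟩ := hcover h U hm
      have hcov : (1 : ℝ) ≤ ∑ h' ∈ Finset.univ.filter (fun h' => proj h' = h), w h' U * χB h' U :=
        hone.trans (Finset.single_le_sum (f := fun h' => w h' U * χB h' U)
          (fun h' _ => mul_nonneg (hw0 h' U) (hχ0 h' U)) (Finset.mem_filter.mpr ⟨Finset.mem_univ _, hh₁⟩))
      calc m₀ h U * Real.exp (F₀ h U) = 1 * (m₀ h U * Real.exp (F₀ h U)) := (one_mul _).symm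
        _ ≤ _ := mul_le_mul_of_nonneg_right hcov hpos
  -- Step D: split the transported refined sum
  have hD : ∀ h, rnTransport avg (fun U => ∑ h' ∈ Finset.univ.filter (fun h' => proj h' = h), g h' U)
      =ᵐ[fieldMeasure P (j + 1) G] fun V => ∑ h' ∈ Finset.univ.filter (fun h' => proj h' = h), rnTransport avg (g h') V :=
    fun h => rnTransport_sum_ae hac _ g fun h' _ => hgi h'
  have hC' := ae_all_iff.mpr hC
  have hD' := ae_all_iff.mpr hD
  have hE' := ae_all_iff.mpr hdirect
  filter_upwards [hA, hBsum, hC', hD', hE'] with V hA hBsum hC hD hE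
  calc rnTransport avg ρ V ≤ rnTransport avg R V := hA
    _ = ∑ h, rnTransport avg (fun U => m₀ h U * Real.exp (F₀ h U)) V := hBsum
    _ ≤ ∑ h, ∑ h' ∈ Finset.univ.filter (fun h' => proj h' = h), rnTransport avg (g h') V :=
        Finset.sum_le_sum fun h _ => (hC h).trans (le_of_eq (hD h))
    _ ≤ ∑ h, ∑ h' ∈ Finset.univ.filter (fun h' => proj h' = h), m₁ h' V * B h' V :=
        Finset.sum_le_sum fun h _ => Finset.sum_le_sum fun h' _ => hE h'
    _ = ∑ h', m₁ h' V * B h' V := Finset.sum_fiberwise Finset.univ proj fun h' => m₁ h' V * B h' V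

omit [Fintype H₀] [Fintype H₁] in
/-- **THE LANE'S FACTORED PAIR IS A SPECIAL CASE**: `hfibre` (factored) + `hm₁` + `B ≥ 0` give `hdirect`. [folklore] -/
theorem direct_of_factored (proj : H₁ → H₀) (m₀ : H₀ → Density P j G) (F₀ : H₀ → GaugeField P j G → ℝ)
    (w χB : H₁ → Density P j G) (m₁ B : H₁ → Density P (j + 1) G)
    (hm₁ : ∀ h', (rnTransport avg fun U => w h' U * m₀ (proj h') U) ≤ᵐ[fieldMeasure P (j + 1) G] m₁ h')
    (hB : ∀ h' V, 0 ≤ B h' V)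
    (hfibre : ∀ h', (rnTransport avg (fun U => w h' U * χB h' U * (m₀ (proj h') U * Real.exp (F₀ (proj h') U))))
      ≤ᵐ[fieldMeasure P (j + 1) G] fun V => rnTransport avg (fun U => w h' U * m₀ (proj h') U) V * B h' V) :
    ∀ h', (rnTransport avg (fun U => w h' U * χB h' U * (m₀ (proj h') U * Real.exp (F₀ (proj h') U))))
      ≤ᵐ[fieldMeasure P (j + 1) G] fun V => m₁ h' V * B h' V := fun h' => by
  filter_upwards [hfibre h', hm₁ h'] with V hE hF
  exact hE.trans (mul_le_mul_of_nonneg_right hF (hB h' V))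

omit [Fintype H₀] [Fintype H₁] in
/-- **WITH THE TRIVIAL MASS PINNED TO `1`, THE DIRECT HYPOTHESIS AT `h′ = triv` IS THE UNFACTORED ROW**: if `m₀(proj triv) = 1` and
`m₁(triv) = 1` (print's trivial-history masses) then an unfactored bound `T[w(triv)·χB(triv)·e^{F₀}] ≤ᵐ χ′·B(triv)` with `χ′ ≤ 1`, `B ≥ 0`
(the shape of §3's `Fibre55TrivAC`, `χ′ = χ_{k+1}`) IS `hdirect` at `triv` — no transport of a constant, no `T_k 1`, no E6′. [folklore] -/
theorem direct_triv_of_unfactored (proj : H₁ → H₀) (triv : H₁) (m₀ : H₀ → Density P j G) (F₀ : H₀ → GaugeField P j G → ℝ)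
    (w χB : H₁ → Density P j G) (m₁ B : H₁ → Density P (j + 1) G) (χ' : Density P (j + 1) G)
    (hm₀t : ∀ U, m₀ (proj triv) U = 1) (hm₁t : ∀ V, m₁ triv V = 1) (hχ'1 : ∀ V, χ' V ≤ 1) (hB : ∀ V, 0 ≤ B triv V)
    (h55 : (rnTransport avg (fun U => w triv U * χB triv U * Real.exp (F₀ (proj triv) U)))
      ≤ᵐ[fieldMeasure P (j + 1) G] fun V => χ' V * B triv V) :
    (rnTransport avg (fun U => w triv U * χB triv U * (m₀ (proj triv) U * Real.exp (F₀ (proj triv) U))))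
      ≤ᵐ[fieldMeasure P (j + 1) G] fun V => m₁ triv V * B triv V := by
  have hfun : (fun U => w triv U * χB triv U * (m₀ (proj triv) U * Real.exp (F₀ (proj triv) U)))
      = fun U => w triv U * χB triv U * Real.exp (F₀ (proj triv) U) := funext fun U => by rw [hm₀t U, one_mul]
  rw [hfun]
  filter_upwards [h55] with V hV
  rw [hm₁t V, one_mul]
  exact hV.trans (mul_le_of_le_one_left (hB V) (hχ'1 V))

end Leaf

end Summit.QuantumFields.YangMills.Cruxes.FluctuationComparisonRegPr.Ideate2Gen6

end
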